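import Mathlib
import Literature.Probability.RandomPlanarGeometry.SelfAvoidingWalk
import Literature.Probability.RandomPlanarGeometry.SAWStripPartitionFunction
import Summits.CriticalPhenomena.SAWScalingLimit.Theses.SAWTotalPositivity

/-!
# Sketch — first lemmas of the crux idea cards for `TPToTraversalBound` (stmt-CriticalPhenomena-10687)

Card A `portal-pinning-clean-disc`: first lemma `CleanDiveSquare` (clean-square Condition G1 as a ratio of
critical SAW weights: walks between two TOP-row points of the unit square that stay out of the bottom third
carry a uniform fraction of the weight of all walks).

Card B `critical-strip-gap`: first lemma `CriticalStripGap` (the point-to-opposite-side x_c-mass of a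
`w × ℓ` lattice rectangle decays like `exp(-a ℓ / w)` — the conformally sized spectral gap of the critical
SAW strip transfer matrix, surface exponent 5/8).

Both are stated over existing declarations only (`SAW.weight`, `SAW.stripPartitionFunction`).
-/

namespace Summit.CriticalPhenomena.SAWScalingLimit.Cruxes.TPToTraversalBound.Sketch

open Literature.Probability.RandomPlanarGeometry Literature.Probability.LatticeModels
open scoped ENNReal Complex

/-- **Card A, first lemma (CleanDive, square form).** There is `ε > 0` such that for every mesh
`δ = 1/(n+2)` and all top-row vertices `(i, n+1)`, `(j, n+1)` of the discretised open unit square, the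
critical SAW weight of the walks joining them inside the TOP TWO THIRDS `(0,1) × (1/3,1)` is at least
`ε` times the weight of all walks joining them in the whole square: the chordal critical SAW between two
points of the top side dives into the bottom third with probability `≤ 1 - ε`, uniformly in the scale and
in the endpoints (Kemppainen–Smirnov Condition G1 for ONE clean shape, ratio form). -/
def CleanDiveSquare : Prop :=
  ∃ ε : ℝ, 0 < ε ∧ ∀ (n : ℕ) (i j : ℤ), 1 ≤ i → i ≤ n + 1 → 1 ≤ j → j ≤ n + 1 →
    ENNReal.ofReal ε *
        SAW.weight (Set.Ioo (0 : ℝ) 1 ×ℂ Set.Ioo (0 : ℝ) 1) (1 / ((n : ℝ) + 2))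
          ![i, (n : ℤ) + 1] ![j, (n : ℤ) + 1] Set.univ
      ≤ SAW.weight (Set.Ioo (0 : ℝ) 1 ×ℂ Set.Ioo ((1 : ℝ) / 3) 1) (1 / ((n : ℝ) + 2))
          ![i, (n : ℤ) + 1] ![j, (n : ℤ) + 1] Set.univ

/-- **Card B, first lemma (CriticalStripGap, one strand).** There are `a > 0` and `C` such that for every
strip width `n ≥ 1`, every length `ℓ` and every starting row `i`, the total critical weight of the SAWs of
the box `{0,…,ℓ} × {1,…,n}` from `(0,i)` to the right column is at most `C · exp(-a ℓ / n)`: crossing an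
`n × (c n)` lattice rectangle lengthwise costs a definite factor `e^{-a c}` per unit of aspect ratio,
uniformly in the lattice width (conformal prediction: `a = 5π/8`). -/
def CriticalStripGap : Prop :=
  ∃ a C : ℝ, 0 < a ∧ ∀ (n ℓ : ℕ) (i : ℤ), 1 ≤ n →
    ∑ j ∈ Finset.Icc (1 : ℤ) n, SAW.stripPartitionFunction n ℓ i j ≤ C * Real.exp (-(a * ℓ / n))

/-- **Card B, target shape of the multi-strand version (CG_M), informal in the docstring; typed here only
for `M = 2` through products is NOT faithful (disjointness matters), so we record the intended consequence
instead: the watermelon law for the chordal SAW.** For every Dobrushin domain and endpoint approximation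
and every `j`, `2j` separate traversals of an interior shell cost `(ρ/R)^{c j^2}`: the exponent in
`SAWTraversalBound` may be taken to grow quadratically in the threshold. (Consequence of CG_M + sector
pigeonhole; stated as the strengthening of the crux's conclusion it would deliver.) -/
def QuadraticTraversalLaw : Prop :=
  ∃ c : ℝ, 0 < c ∧ ∀ (D : DobrushinDomain) (a b : ℝ → Site 2), SAW.IsEndpointApprox D a b →
    ∀ j : ℕ, 1 ≤ j → ∃ (K δ₀ : ℝ), 0 ≤ K ∧ 0 < δ₀ ∧ ∀ δ : ℝ, δ ∈ Set.Ioc (0 : ℝ) δ₀ →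
      ∀ (x : ℂ) (ρ R : ℝ), δ ≤ ρ → ρ < R → Metric.closedBall x R ⊆ D.carrier →
        SAW.law D.carrier δ (a δ) (b δ)
            {γ | (⟨γ.walk.toCurve (meshPoint δ)⟩ : Curve ℂ).HasTraversals (2 * j) x ρ R}
          ≤ ENNReal.ofReal (K * (ρ / R) ^ (c * (j : ℝ) ^ 2))

/-- Sanity: the quadratic law with `j` large (`c j² > 2`) gives the crux's conclusion for interior shells;
recorded as an implication to be proved by the crux-plan (not here). -/
def QuadraticLawFeedsCrux : Prop :=
  QuadraticTraversalLaw → CleanDiveSquare →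
    Summit.CriticalPhenomena.SAWScalingLimit.Theses.SAWTotalPositivity.TPToTraversalBound

end Summit.CriticalPhenomena.SAWScalingLimit.Cruxes.TPToTraversalBound.Sketch
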